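import Mathlib.Analysis.SpecialFunctions.Trigonometric.Bounds
import HarnessLib

/-!
# BalabanUVNodes ∕ N15 — THE KING-MODEL RUNG, CURVED EDITION (PART Κ-a): KING's CONTOURS (2.12) AS STEP LISTS — the functional `A(Γ) = Σ_{b∈Γ} εA_b`
# of a CONSTANT field, subdivision, the straight staircases `Γ_{z,w}`, the block contours `Γ^{(k)}_{y,x}`, and THEIR NESTING `Γ^{(k+n)}_{y,x′} = Γ^{(k)}_{y,x} ∪ Γ^{(n)}_{x,x′}`
# AS A LIST IDENTITY; ordered products of bond transporters along nested contours (the letters of King's (3.72), part Κ-b)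
# (Track A, DAG node N15 = NE2; FAN-OUT v1.1 §N15 s3 «KING-MODEL RUNG … + the one-line statement of what the curved case adds»)

HONEST FRAMING.  Count-neutral (cell `pub-ymgap`, seat `pub-ymgap-dag-n15-e` g24; `--supports stmt-QuantumFields-27366 --as helper` = K3⁸
`SpineGivenEndpointR13SepCoPHV`).  TEMPLATE LITERATURE: C. King, *The U(1) Higgs model. I. The continuum limit*, Commun. Math. Phys. **102** (1986) 649–677
[King1986] — the COMBINATORICS of the contours (2.12) p. 653 and of the functional `A(Γ)`, generic in the dimension `D`; the consumer is part Κ-b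
(`…KingModelContourPhaseRate`: King's (3.72) p. 665 BY NAME on `SlicePropagator.Ineq372Printed`).  NOT Bałaban's non-abelian `G(U)` of [B9]; NOT a node
discharge; nothing continuum ∕ ℝ⁴ ∕ OS ∕ mass-gap ∕ Clay.  0 `sorry`; standard axioms; elementary (lists, digits, a normed-ring telescoping).  Page render READ
AS IMAGE: `run/shared/lean/pub/pub-balaban/b2b-balaban-template/king-renders/1986-cmp102-king-u1-higgs-I-p005-x2.png` (p. 653).

THE PRINT.  p. 653, verbatim: *«To each point y ∈ L^kεZ^d there corresponds a block of L^{kd} sites on εZ^d, which we define as B^k(y) = {x ∈ εZ^d : y_i ≤ x_i <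
y_i + L^kε, i = 1, …, d}. … where the contour Γ^{(k)}_{y,x} connects y to x in the following way; writing x_j as the site for which x ∈ B^j(x_j), we have
Γ^{(k)}_{y,x} = Γ_{y,x_{k−1}} ∪ Γ_{x_{k−1},x_{k−2}} ∪ … Γ_{x_1,x} and the contour Γ_{z,w} is a union of bonds on εZ^d given by Γ_{z,w} = ⟨z, (z_1, …, z_{d−1}, w_d)⟩ ∪
⟨(z_1, …, z_{d−1}, w_d), (z_1, …, z_{d−2}, w_{d−1}, w_d)⟩ ∪ … ∪ ⟨(z_1, …, w_d), w⟩. (2.12)  Furthermore, A(Γ) = Σ_{b∈Γ} εA_b and U(A(Γ)) = exp[eqA(Γ)].»*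

WHAT THIS FILE PROVES (namespace `Summit.QuantumFields.YangMills.BalabanUVNodes.N15KingModelRung.Contour`; a contour from a given start point = its LIST
OF STEPS `ContourStep D = Fin D × Bool` (direction, orientation), i.e. (2.12)'s «union of bonds» read in the printed order).
* §1 `stepWeight`, ★ `contourSum η B Γ = Σ_{b∈Γ} ηB_b` for a CONSTANT field `B` (`B_b = ±B_{μ(b)}`): `contourSum_append` (additivity under `∪`),
  `contourSum_replicate`, `abs_contourSum_le` (`|B(Γ)| ≤ η‖B‖_∞|Γ|`); SUBDIVISION `subdivide m Γ` (each bond ↦ `m` consecutive bonds of spacing `η∕m`):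
  `subdivide_append`, `subdivide_replicate`, ★ `contourSum_subdivide` (`B` along the subdivided contour at spacing `η′` = `B` along the contour at spacing
  `mη′`); King's straight staircase `straightPiece o` (directions `d, d−1, …, 1` as printed, `o_μ = (w − z)_μ∕ε` POSITIVE steps each — `w ∈ B(z)`):
  ★ `contourSum_straightPiece = η·Σ_μ o_μB_μ` (`= B·(w − z)`), `length_straightPiece = Σ_μ o_μ`, `subdivide_straightPiece`; King's block contour
  `blockContour L K v` = the concatenation over the levels `j = K−1, …, 0` of the straight pieces `Γ_{x_{j+1},x_j}`, offsets `(digit_j v_μ)·L^j`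
  (`digitRun`; `v` = the fine coordinates of `x` from the base point `y = x_K` of its `L^K`-block): ★★ `contourSum_blockContour = η·Σ_μ (v_μ mod L^K)·B_μ`
  (`= B·(x − y)`, through the digit sum `sum_digitRun_range`: `Σ_{j<K} (⌊v∕L^j⌋ mod L)L^j = v mod L^K`), `length_blockContour (= Σ_μ v_μ mod L^K) ≤ D·L^K`,
  and ★★★ **`blockContour_nested`**: `Γ^{(K+n)}(v′) = subdivide (L^n) (Γ^{(K)}(⌊v′∕L^n⌋)) ++ Γ^{(n)}(v′)` — THE NESTING OF (2.12) AS A LIST IDENTITY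
  (`x′_n = x`, `x′_{n+j} = x_j`: the digits of `v′` at the levels `n + j` are the digits of `⌊v′∕L^n⌋` at the levels `j`, `digitRun_add`).
* §2 (generic normed ring `R`, NO commutativity) for bond transporters of norm `≤ 1`: `norm_prod_sub_one_le` (`‖ΠU_b − 1‖ ≤ Σ‖U_b − 1‖`), `norm_prod_le_one`,
  ★★ **`norm_prod_append_sub_prod_le`**: `‖Π(Γ ++ T) − Π(Γ)‖ ≤ Σ_{b∈T} ‖U_b − 1‖` — along NESTED contours the ordered products differ by the tail only
  (nesting, not path-independence); `prod_map_subdivide` (along a subdivided contour the product is the product of `m`-th powers = the coarse-bond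
  transporters of a constant background), `sum_map_norm_sub_one_le`, and ★★ **`norm_headed_prod_nested_sub_le`**: THE SHAPE OF (3.72) WITHOUT COMMUTATIVITY —
  for `‖U_s‖ ≤ 1`, `‖U_s − 1‖ ≤ θ`, a head `g` of norm `≤ 1`: `‖g·Π(Γ^{(K+n)}(v′)) − g·Π_{coarse}(Γ^{(K)}(⌊v′∕L^n⌋))‖ ≤ D·L^n·θ` (`= D·e·s·‖B‖_∞·η` at
  `θ = e·s·η′‖B‖_∞`); the U(1) letters `stepTransporter` (`exp[i·e·s·η·(±B_μ)]`) and `cexp_contourSum_eq_prod` (`exp[i·e·s·B(Γ)] = Π_b U_b`).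

HONEST SCOPE.  Pure bookkeeping of (2.12) for a constant field: no lattice sites are built here (part Κ-b places the contours on the rung's tori through the
fine coordinates), no plaquette ∕ curvature object, no operator of [King1986] §2; §2 is a mechanism lemma over an abstract normed ring.
Locators: [King1986] (2.10)–(2.12) p.653, (3.46) p.661, (3.72) p.665.
-/

noncomputable section

namespace Summit.QuantumFields.YangMills.BalabanUVNodes.N15KingModelRung.Contour

open scoped BigOperators

/-! ## §1 Contours as step lists: King's functional `A(Γ) = Σ_{b∈Γ} εA_b` for a constant field, subdivision, the staircases (2.12), nesting -/

section Steps

variable {D : ℕ}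

/-- A lattice STEP of a contour: a direction `μ` and an orientation (`true` = `+e_μ`).  A contour from a given start point is its list of steps
(the «union of bonds» of (2.12) read in order). [cite: King1986, (2.12) p.653] -/
abbrev ContourStep (D : ℕ) : Type := Fin D × Bool

/-- The weight `±B_μ` of a step for a CONSTANT vector field `B` (`B_b = B_{μ(b)}`, sign = orientation). [cite: King1986, (2.12) p.653 («A(Γ) = Σ_{b∈Γ} εA_b»)] -/
def stepWeight (B : Fin D → ℝ) (s : ContourStep D) : ℝ := if s.2 then B s.1 else -B s.1

/-- **KING's CONTOUR FUNCTIONAL** `B(Γ) = Σ_{b∈Γ} ηB_b` for a constant field `B` on a lattice of spacing `η`. [cite: King1986, (2.12) p.653, (3.46) p.661] -/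
def contourSum (η : ℝ) (B : Fin D → ℝ) (Γ : List (ContourStep D)) : ℝ := (Γ.map fun s => η * stepWeight B s).sum

/-- the empty contour carries no phase. [cite: King1986, (2.12) p.653] -/
@[simp] theorem contourSum_nil (η : ℝ) (B : Fin D → ℝ) : contourSum η B [] = 0 := by simp [contourSum]

/-- one step. [cite: King1986, (2.12) p.653] -/
@[simp] theorem contourSum_cons (η : ℝ) (B : Fin D → ℝ) (s : ContourStep D) (Γ : List (ContourStep D)) :
    contourSum η B (s :: Γ) = η * stepWeight B s + contourSum η B Γ := by simp [contourSum]

/-- **additivity under concatenation** (`Γ₁ ∪ Γ₂` of (2.12)). [cite: King1986, (2.12) p.653] -/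
theorem contourSum_append (η : ℝ) (B : Fin D → ℝ) (Γ₁ Γ₂ : List (ContourStep D)) :
    contourSum η B (Γ₁ ++ Γ₂) = contourSum η B Γ₁ + contourSum η B Γ₂ := by
  simp [contourSum, List.map_append, List.sum_append]

/-- a run of `m` equal steps. [cite: King1986, (2.12) p.653] -/
theorem contourSum_replicate (η : ℝ) (B : Fin D → ℝ) (m : ℕ) (s : ContourStep D) :
    contourSum η B (List.replicate m s) = (m : ℝ) * (η * stepWeight B s) := by
  simp [contourSum, List.map_replicate, List.sum_replicate, nsmul_eq_mul]

/-- a step weighs at most `‖B‖_∞`. [cite: King1986, (3.2) p.655] -/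
theorem abs_stepWeight_le {B : Fin D → ℝ} {β : ℝ} (hB : ∀ μ, |B μ| ≤ β) (s : ContourStep D) : |stepWeight B s| ≤ β := by
  unfold stepWeight
  split_ifs
  · exact hB s.1
  · rw [abs_neg]; exact hB s.1

/-- `|B(Γ)| ≤ η·‖B‖_∞·|Γ|`. [cite: King1986, (2.12) p.653, (3.2) p.655] -/
theorem abs_contourSum_le {η : ℝ} (hη : 0 ≤ η) {B : Fin D → ℝ} {β : ℝ} (hB : ∀ μ, |B μ| ≤ β) (Γ : List (ContourStep D)) :
    |contourSum η B Γ| ≤ η * β * Γ.length := by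
  induction Γ with
  | nil => simp
  | cons s Γ ih =>
      rw [contourSum_cons, List.length_cons, Nat.cast_succ]
      calc |η * stepWeight B s + contourSum η B Γ| ≤ |η * stepWeight B s| + |contourSum η B Γ| := abs_add_le _ _
        _ ≤ η * β + η * β * Γ.length := by
            refine add_le_add ?_ ih
            rw [abs_mul, abs_of_nonneg hη]
            exact mul_le_mul_of_nonneg_left (abs_stepWeight_le hB s) hη
        _ = η * β * (Γ.length + 1) := by ring

/-- **SUBDIVISION**: every step replaced by `m` consecutive copies (a bond of the `η`-lattice is the union of `m = L^n` bonds of the `η′`-lattice,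
`η′ = η∕L^n`). [cite: King1986, (2.12) p.653, p.664 («x′ ∈ B^n(x)»)] -/
def subdivide (m : ℕ) (Γ : List (ContourStep D)) : List (ContourStep D) := Γ.flatMap fun s => List.replicate m s

/-- subdivision of a concatenation. [cite: King1986, (2.12) p.653] -/
theorem subdivide_append (m : ℕ) (Γ₁ Γ₂ : List (ContourStep D)) : subdivide m (Γ₁ ++ Γ₂) = subdivide m Γ₁ ++ subdivide m Γ₂ := by
  simp [subdivide, List.flatMap_append]

/-- subdivision of a run is a longer run. [cite: King1986, (2.12) p.653] -/
theorem subdivide_replicate (m k : ℕ) (s : ContourStep D) : subdivide m (List.replicate k s) = List.replicate (k * m) s := by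
  induction k with
  | zero => simp [subdivide]
  | succ k ih =>
      rw [List.replicate_succ, Nat.succ_mul]
      show (List.replicate m s ++ (List.replicate k s).flatMap fun s => List.replicate m s) = _
      rw [show ((List.replicate k s).flatMap fun s => List.replicate m s) = subdivide m (List.replicate k s) from rfl, ih,
        ← List.replicate_add, Nat.add_comm]

/-- **the phase is invariant under subdivision**: `m` bonds of spacing `η′` carry the phase of one bond of spacing `mη′`. [cite: King1986, (2.12) p.653] -/
theorem contourSum_subdivide (η : ℝ) (B : Fin D → ℝ) (m : ℕ) (Γ : List (ContourStep D)) :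
    contourSum η B (subdivide m Γ) = contourSum ((m : ℝ) * η) B Γ := by
  induction Γ with
  | nil => simp [subdivide]
  | cons s Γ ih =>
      have h : subdivide m (s :: Γ) = List.replicate m s ++ subdivide m Γ := rfl
      rw [h, contourSum_append, contourSum_replicate, ih, contourSum_cons]
      ring

/-- King's straight pieces as runs: for a list of directions, `o_μ` positive steps in direction `μ`, in the listed order. [cite: King1986, (2.12) p.653] -/
def stepRuns (o : Fin D → ℕ) : List (Fin D) → List (ContourStep D)
  | [] => []
  | μ :: l => List.replicate (o μ) (μ, true) ++ stepRuns o l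

/-- **KING's STRAIGHT STAIRCASE `Γ_{z,w}` (2.12)** for `w ∈ B(z)`, offsets `o = w − z ≥ 0` (coordinatewise): the `d`-th coordinate is changed first, then the
`(d−1)`-th, …, then the first — stepRuns of POSITIVELY oriented steps. [cite: King1986, (2.12) p.653] -/
def straightPiece (o : Fin D → ℕ) : List (ContourStep D) := stepRuns o (List.finRange D).reverse

/-- the phase along runs. [cite: King1986, (2.12) p.653] -/
theorem contourSum_stepRuns (η : ℝ) (B : Fin D → ℝ) (o : Fin D → ℕ) (l : List (Fin D)) :
    contourSum η B (stepRuns o l) = η * (l.map fun μ => (o μ : ℝ) * B μ).sum := by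
  induction l with
  | nil => simp [stepRuns]
  | cons μ l ih =>
      show contourSum η B (List.replicate (o μ) (μ, true) ++ stepRuns o l) = _
      rw [contourSum_append, contourSum_replicate, ih, List.map_cons, List.sum_cons]
      simp only [stepWeight, if_true]
      ring

/-- **`B(Γ_{z,w}) = Σ_μ B_μ(w − z)_μ`** — the phase of the straight staircase is the field dotted into the displacement. [cite: King1986, (2.12) p.653] -/
theorem contourSum_straightPiece (η : ℝ) (B : Fin D → ℝ) (o : Fin D → ℕ) :
    contourSum η B (straightPiece o) = η * ∑ μ, (o μ : ℝ) * B μ := by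
  rw [straightPiece, contourSum_stepRuns, List.map_reverse, List.sum_reverse, ← List.ofFn_eq_map, List.sum_ofFn]

/-- the number of bonds of the runs. [cite: King1986, (2.12) p.653] -/
theorem length_stepRuns (o : Fin D → ℕ) (l : List (Fin D)) : (stepRuns o l).length = (l.map o).sum := by
  induction l with
  | nil => simp [stepRuns]
  | cons μ l ih =>
      show (List.replicate (o μ) (μ, true) ++ stepRuns o l).length = _
      rw [List.length_append, List.length_replicate, ih, List.map_cons, List.sum_cons]

/-- `|Γ_{z,w}| = Σ_μ (w − z)_μ`. [cite: King1986, (2.12) p.653] -/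
theorem length_straightPiece (o : Fin D → ℕ) : (straightPiece o).length = ∑ μ, o μ := by
  rw [straightPiece, length_stepRuns, List.map_reverse, List.sum_reverse, ← List.ofFn_eq_map, List.sum_ofFn]

/-- subdividing runs multiplies their lengths. [cite: King1986, (2.12) p.653] -/
theorem subdivide_stepRuns (m : ℕ) (o : Fin D → ℕ) (l : List (Fin D)) : subdivide m (stepRuns o l) = stepRuns (fun μ => o μ * m) l := by
  induction l with
  | nil => simp [stepRuns, subdivide]
  | cons μ l ih =>
      show subdivide m (List.replicate (o μ) (μ, true) ++ stepRuns o l) = List.replicate (o μ * m) (μ, true) ++ stepRuns (fun μ => o μ * m) l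
      rw [subdivide_append, subdivide_replicate, ih]

/-- subdividing a straight staircase by `m` is the straight staircase of the `m`-fold offsets (same point set on the finer lattice). [cite: King1986, (2.12) p.653] -/
theorem subdivide_straightPiece (m : ℕ) (o : Fin D → ℕ) : subdivide m (straightPiece o) = straightPiece fun μ => o μ * m := by
  unfold straightPiece; exact subdivide_stepRuns m o _

/-- THE LEVEL-`j` OFFSETS of King's block staircase: from `x_{j+1}` (the site of the `L^{j+1}`-lattice with `x ∈ B^{j+1}(x_{j+1})`) to `x_j` one moves
`(digit_j v_μ)·L^j` fine steps in direction `μ`, `digit_j v = ⌊v∕L^j⌋ mod L`, `v` = the fine coordinates of `x` counted from the base point.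
[cite: King1986, (2.10)–(2.12) p.653] -/
def digitRun (L : ℕ) (v : Fin D → ℕ) (j : ℕ) : Fin D → ℕ := fun μ => v μ / L ^ j % L * L ^ j

/-- the concatenation of the straight pieces over a list of levels. [cite: King1986, (2.12) p.653] -/
def levelPieces (L : ℕ) (v : Fin D → ℕ) : List ℕ → List (ContourStep D)
  | [] => []
  | j :: l => straightPiece (digitRun L v j) ++ levelPieces L v l

/-- **KING's BLOCK CONTOUR `Γ^{(K)}_{y,x} = Γ_{y,x_{K−1}} ∪ Γ_{x_{K−1},x_{K−2}} ∪ … ∪ Γ_{x_1,x}` (2.12)** as a step list, levels `K−1, …, 0` in the printed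
order, for a point with fine coordinates `v` (the unit block's base point `y = x_K` has `v ≡ 0 mod L^K`). [cite: King1986, (2.12) p.653] -/
def blockContour (L K : ℕ) (v : Fin D → ℕ) : List (ContourStep D) := levelPieces L v (List.range K).reverse

/-- levels concatenate. [cite: King1986, (2.12) p.653] -/
theorem levelPieces_append (L : ℕ) (v : Fin D → ℕ) (l₁ l₂ : List ℕ) : levelPieces L v (l₁ ++ l₂) = levelPieces L v l₁ ++ levelPieces L v l₂ := by
  induction l₁ with
  | nil => rfl
  | cons j l ih => show straightPiece (digitRun L v j) ++ levelPieces L v (l ++ l₂) = (straightPiece (digitRun L v j) ++ levelPieces L v l) ++ levelPieces L v l₂; rw [ih, List.append_assoc]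

/-- the phase along the levels. [cite: King1986, (2.12) p.653] -/
theorem contourSum_levelPieces (η : ℝ) (B : Fin D → ℝ) (L : ℕ) (v : Fin D → ℕ) (l : List ℕ) :
    contourSum η B (levelPieces L v l) = η * ∑ μ, ((l.map fun j => (digitRun L v j μ : ℝ)).sum) * B μ := by
  induction l with
  | nil => simp [levelPieces]
  | cons j l ih =>
      show contourSum η B (straightPiece (digitRun L v j) ++ levelPieces L v l) = _
      rw [contourSum_append, contourSum_straightPiece, ih, ← mul_add, ← Finset.sum_add_distrib]
      congr 1
      refine Finset.sum_congr rfl fun μ _ => ?_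
      rw [List.map_cons, List.sum_cons]; ring

/-- the number of bonds along the levels. [cite: King1986, (2.12) p.653] -/
theorem length_levelPieces (L : ℕ) (v : Fin D → ℕ) (l : List ℕ) : (levelPieces L v l).length = ∑ μ, (l.map fun j => digitRun L v j μ).sum := by
  induction l with
  | nil => simp [levelPieces]
  | cons j l ih =>
      show (straightPiece (digitRun L v j) ++ levelPieces L v l).length = _
      rw [List.length_append, length_straightPiece, ih, ← Finset.sum_add_distrib]
      refine Finset.sum_congr rfl fun μ _ => ?_
      rw [List.map_cons, List.sum_cons]

/-- **THE DIGIT SUM**: `Σ_{j<K} (⌊v∕L^j⌋ mod L)·L^j = v mod L^K`. [folklore] -/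
theorem sum_digitRun_range (L : ℕ) (v : Fin D → ℕ) (μ : Fin D) (K : ℕ) :
    ∑ j ∈ Finset.range K, digitRun L v j μ = v μ % L ^ K := by
  induction K with
  | zero => simp [Nat.mod_one]
  | succ K ih => rw [Finset.sum_range_succ, ih, Nat.mod_pow_succ]; simp [digitRun, mul_comm]

/-- list form of the digit sum over the reversed range. [folklore] -/
theorem sum_digitRun_reverse_range (L : ℕ) (v : Fin D → ℕ) (μ : Fin D) (K : ℕ) :
    (((List.range K).reverse).map fun j => digitRun L v j μ).sum = v μ % L ^ K := by
  rw [List.map_reverse, List.sum_reverse, ← sum_digitRun_range L v μ K, ← List.toFinset_range, List.sum_toFinset _ List.nodup_range]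

/-- ★ **`B(Γ^{(K)}_{y,x}) = η·Σ_μ (v_μ mod L^K)·B_μ = B·(x − y)`** — the phase of King's block contour is the field dotted into the in-block offset of `x`.
[cite: King1986, (2.12) p.653, (3.46) p.661] -/
theorem contourSum_blockContour (η : ℝ) (B : Fin D → ℝ) (L K : ℕ) (v : Fin D → ℕ) :
    contourSum η B (blockContour L K v) = η * ∑ μ, ((v μ % L ^ K : ℕ) : ℝ) * B μ := by
  rw [blockContour, contourSum_levelPieces]
  congr 1
  refine Finset.sum_congr rfl fun μ _ => ?_
  rw [← sum_digitRun_reverse_range L v μ K]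
  simp only [Nat.cast_list_sum, List.map_map, Function.comp_def]

/-- `|Γ^{(K)}_{y,x}| = Σ_μ (v_μ mod L^K)` bonds. [cite: King1986, (2.12) p.653] -/
theorem length_blockContour (L K : ℕ) (v : Fin D → ℕ) : (blockContour L K v).length = ∑ μ, v μ % L ^ K := by
  rw [blockContour, length_levelPieces]
  exact Finset.sum_congr rfl fun μ _ => sum_digitRun_reverse_range L v μ K

/-- `|Γ^{(K)}_{y,x}| ≤ D·(L^K − 1)` … in the weak form `≤ D·L^K` we use. [cite: King1986, (2.12) p.653] -/
theorem length_blockContour_le (L K : ℕ) (hL : 0 < L) (v : Fin D → ℕ) : (blockContour L K v).length ≤ D * L ^ K := by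
  rw [length_blockContour]
  calc ∑ μ, v μ % L ^ K ≤ ∑ _μ : Fin D, L ^ K := Finset.sum_le_sum fun μ _ => (Nat.mod_lt _ (pow_pos hL K)).le
    _ = D * L ^ K := by rw [Finset.sum_const, Finset.card_univ, Fintype.card_fin, smul_eq_mul]

/-- the digits of the fine coordinates at the levels `n + j` are the digits of the coarse coordinates `⌊v′∕L^n⌋` at the levels `j`, the runs `L^n` times
longer (the coarse `η`-bonds subdivided). [cite: King1986, (2.12) p.653, p.664 (pairing)] -/
theorem digitRun_add (L : ℕ) (v' : Fin D → ℕ) (n j : ℕ) :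
    digitRun L v' (n + j) = fun μ => digitRun L (fun ν => v' ν / L ^ n) j μ * L ^ n := by
  funext μ
  simp only [digitRun]
  rw [pow_add, ← Nat.div_div_eq_div_mul]
  ring

/-- the head levels of the fine contour are the subdivided coarse contour. [cite: King1986, (2.12) p.653] -/
theorem levelPieces_map_add (L : ℕ) (v' : Fin D → ℕ) (n : ℕ) (l : List ℕ) :
    levelPieces L v' (l.map fun j => n + j) = subdivide (L ^ n) (levelPieces L (fun ν => v' ν / L ^ n) l) := by
  induction l with
  | nil => simp [levelPieces, subdivide]
  | cons j l ih =>
      show straightPiece (digitRun L v' (n + j)) ++ levelPieces L v' (l.map fun j => n + j)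
        = subdivide (L ^ n) (straightPiece (digitRun L (fun ν => v' ν / L ^ n) j) ++ levelPieces L (fun ν => v' ν / L ^ n) l)
      rw [subdivide_append, subdivide_straightPiece, ih, digitRun_add]

/-- ★★ **THE NESTING OF KING's CONTOURS (2.12), AS A LIST IDENTITY**: for fine coordinates `v′` and the coarse ones `⌊v′∕L^n⌋` (King's `x′ ∈ B^n(x)`),
`Γ^{(K+n)}_{y,x′} = [Γ^{(K)}_{y,x} subdivided by L^n] ++ Γ^{(n)}_{x,x′}`. [cite: King1986, (2.12) p.653, p.664 («x′ ∈ B^n(x)»)] -/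
theorem blockContour_nested (L K n : ℕ) (v' : Fin D → ℕ) :
    blockContour L (K + n) v' = subdivide (L ^ n) (blockContour L K fun ν => v' ν / L ^ n) ++ blockContour L n v' := by
  rw [blockContour, blockContour, blockContour, Nat.add_comm K n, List.range_add, List.reverse_append, ← List.map_reverse, levelPieces_append,
    levelPieces_map_add]

end Steps

/-! ## §2 The mechanism without commutativity: ordered products of bond transporters along NESTED contours -/

section Ordered

variable {R : Type*} [NormedRing R] [NormOneClass R]

omit [NormOneClass R] in
/-- for transporters of norm `≤ 1`, `‖Π_{b∈Γ} U_b − 1‖ ≤ Σ_{b∈Γ} ‖U_b − 1‖` (ordered product; `uv − 1 = u(v − 1) + (u − 1)`). [folklore] -/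
theorem norm_prod_sub_one_le (l : List R) (hl : ∀ u ∈ l, ‖u‖ ≤ 1) : ‖l.prod - 1‖ ≤ (l.map fun u => ‖u - 1‖).sum := by
  induction l with
  | nil => simp
  | cons u l ih =>
      rw [List.prod_cons, List.map_cons, List.sum_cons]
      have hu : ‖u‖ ≤ 1 := hl u (by simp)
      have ih' := ih fun v hv => hl v (by simp [hv])
      have hsplit : u * l.prod - 1 = u * (l.prod - 1) + (u - 1) := by noncomm_ring
      rw [hsplit]
      calc ‖u * (l.prod - 1) + (u - 1)‖ ≤ ‖u * (l.prod - 1)‖ + ‖u - 1‖ := norm_add_le _ _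
        _ ≤ ‖u‖ * ‖l.prod - 1‖ + ‖u - 1‖ := add_le_add (norm_mul_le _ _) le_rfl
        _ ≤ 1 * (l.map fun u => ‖u - 1‖).sum + ‖u - 1‖ :=
            add_le_add (mul_le_mul hu ih' (norm_nonneg _) zero_le_one) le_rfl
        _ = ‖u - 1‖ + (l.map fun u => ‖u - 1‖).sum := by ring

/-- a product of transporters of norm `≤ 1` has norm `≤ 1`. [folklore] -/
theorem norm_prod_le_one (l : List R) (hl : ∀ u ∈ l, ‖u‖ ≤ 1) : ‖l.prod‖ ≤ 1 := by
  induction l with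
  | nil => simp
  | cons u l ih =>
      rw [List.prod_cons]
      have hu : ‖u‖ ≤ 1 := hl u (by simp)
      have ih' := ih fun v hv => hl v (by simp [hv])
      calc ‖u * l.prod‖ ≤ ‖u‖ * ‖l.prod‖ := norm_mul_le _ _
        _ ≤ 1 * 1 := mul_le_mul hu ih' (norm_nonneg _) zero_le_one
        _ = 1 := one_mul _

/-- ★★ **NESTING, NOT PATH-INDEPENDENCE**: along nested contours `Γ′ = Γ ++ T` the ordered products of bond transporters of norm `≤ 1` in ANY normed ring
differ by at most the tail's total deviation from `1`: `‖Π(Γ ++ T) − Π(Γ)‖ ≤ Σ_{b∈T} ‖U_b − 1‖` — the two-spacing rate of the dressing (3.72) survives for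
non-commuting transporters, because King's contours (2.12) are nested. [cite: King1986, (3.72) p.665, (2.12) p.653] -/
theorem norm_prod_append_sub_prod_le (Γ T : List R) (hΓ : ∀ u ∈ Γ, ‖u‖ ≤ 1) (hT : ∀ u ∈ T, ‖u‖ ≤ 1) :
    ‖(Γ ++ T).prod - Γ.prod‖ ≤ (T.map fun u => ‖u - 1‖).sum := by
  rw [List.prod_append, show Γ.prod * T.prod - Γ.prod = Γ.prod * (T.prod - 1) by noncomm_ring]
  calc ‖Γ.prod * (T.prod - 1)‖ ≤ ‖Γ.prod‖ * ‖T.prod - 1‖ := norm_mul_le _ _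
    _ ≤ 1 * (T.map fun u => ‖u - 1‖).sum := mul_le_mul (norm_prod_le_one Γ hΓ) (norm_prod_sub_one_le T hT) (norm_nonneg _) zero_le_one
    _ = (T.map fun u => ‖u - 1‖).sum := one_mul _

omit [NormOneClass R] in
/-- along a SUBDIVIDED contour the ordered product of fine-bond transporters is the product of their `m`-th powers — the coarse-bond transporter of a
constant background (`exp(ηB_μ) = exp(η′B_μ)^{L^n}`, each `B_μ` commuting with itself; different directions need NOT commute). [cite: King1986, (2.12) p.653] -/
theorem prod_map_subdivide {D : ℕ} (U : ContourStep D → R) (m : ℕ) (Γ : List (ContourStep D)) :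
    ((subdivide m Γ).map U).prod = (Γ.map fun s => U s ^ m).prod := by
  induction Γ with
  | nil => simp [subdivide]
  | cons s Γ ih =>
      have h : subdivide m (s :: Γ) = List.replicate m s ++ subdivide m Γ := rfl
      rw [h, List.map_append, List.prod_append, ih, List.map_replicate, List.prod_replicate, List.map_cons, List.prod_cons]

omit [NormOneClass R] in
/-- the total deviation of a contour's transporters from `1` is at most `|Γ|·θ`. [folklore] -/
theorem sum_map_norm_sub_one_le {D : ℕ} (U : ContourStep D → R) {θ : ℝ} (hθ : ∀ s, ‖U s - 1‖ ≤ θ) (Γ : List (ContourStep D)) :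
    ((Γ.map U).map fun u => ‖u - 1‖).sum ≤ (Γ.length : ℝ) * θ := by
  induction Γ with
  | nil => simp
  | cons s Γ ih =>
      rw [List.map_cons, List.map_cons, List.sum_cons, List.length_cons, Nat.cast_succ, add_mul, one_mul, add_comm]
      exact add_le_add ih (hθ s)

/-- ★★ **THE SHAPE OF (3.72) WITHOUT COMMUTATIVITY**: bond transporters `U_s` of norm `≤ 1` with `‖U_s − 1‖ ≤ θ` on the `η′`-lattice (a constant, possibly
NON-COMMUTING background: the coarse `η`-bond transporter is the `L^n`-th power), a head transporter `g` of norm `≤ 1` (the unit-lattice part `Γ_{x₀,y}`):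
the dressings along King's nested contours `Γ^{(K+n)}_{y,x′}` and `Γ^{(K)}_{y,x}` differ by at most `D·L^n·θ` — with `θ = e·s·η′·‖B‖_∞` this is
`D·e·s·‖B‖_∞·η`, the abelian (3.72) verbatim. [cite: King1986, (3.72) p.665, (2.12) p.653] -/
theorem norm_headed_prod_nested_sub_le {D : ℕ} (U : ContourStep D → R) (hU : ∀ s, ‖U s‖ ≤ 1) {θ : ℝ} (hθ0 : 0 ≤ θ) (hθ : ∀ s, ‖U s - 1‖ ≤ θ)
    (g : R) (hg : ‖g‖ ≤ 1) (L K n : ℕ) (hL : 0 < L) (v' : Fin D → ℕ) :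
    ‖g * ((blockContour L (K + n) v').map U).prod - g * ((blockContour L K fun ν => v' ν / L ^ n).map fun s => U s ^ L ^ n).prod‖
      ≤ (D : ℝ) * (L : ℝ) ^ n * θ := by
  rw [blockContour_nested, List.map_append, ← prod_map_subdivide, ← mul_sub]
  have hmem : ∀ u ∈ (subdivide (L ^ n) (blockContour L K fun ν => v' ν / L ^ n)).map U, ‖u‖ ≤ 1 := by
    intro u hu; obtain ⟨s, -, rfl⟩ := List.mem_map.1 hu; exact hU s
  have hmemT : ∀ u ∈ (blockContour L n v').map U, ‖u‖ ≤ 1 := by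
    intro u hu; obtain ⟨s, -, rfl⟩ := List.mem_map.1 hu; exact hU s
  calc ‖g * (((subdivide (L ^ n) (blockContour L K fun ν => v' ν / L ^ n)).map U ++ (blockContour L n v').map U).prod
          - ((subdivide (L ^ n) (blockContour L K fun ν => v' ν / L ^ n)).map U).prod)‖
      ≤ ‖g‖ * ‖(((subdivide (L ^ n) (blockContour L K fun ν => v' ν / L ^ n)).map U ++ (blockContour L n v').map U).prod
          - ((subdivide (L ^ n) (blockContour L K fun ν => v' ν / L ^ n)).map U).prod)‖ := norm_mul_le _ _
    _ ≤ 1 * (((blockContour L n v').map U).map fun u => ‖u - 1‖).sum :=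
        mul_le_mul hg (norm_prod_append_sub_prod_le _ _ hmem hmemT) (norm_nonneg _) zero_le_one
    _ ≤ ((blockContour L n v').length : ℝ) * θ := by rw [one_mul]; exact sum_map_norm_sub_one_le U hθ _
    _ ≤ ((D * L ^ n : ℕ) : ℝ) * θ := mul_le_mul_of_nonneg_right (by exact_mod_cast length_blockContour_le L n hL v') hθ0
    _ = (D : ℝ) * (L : ℝ) ^ n * θ := by push_cast; ring

/-- the U(1) bond transporter of a step: `exp[i·e·s·η·(±B_μ)]`. [cite: King1986, (2.11)–(2.12) p.653, (3.46) p.661] -/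
def stepTransporter {D : ℕ} (e s η : ℝ) (B : Fin D → ℝ) (st : ContourStep D) : ℂ :=
  Complex.exp (Complex.I * ((e * s * (η * stepWeight B st) : ℝ) : ℂ))

/-- the U(1) phase of a contour is the ordered product of its bond transporters (abelian case: `exp Σ = Π exp`). [cite: King1986, (2.11)–(2.12) p.653] -/
theorem cexp_contourSum_eq_prod {D : ℕ} (e s η : ℝ) (B : Fin D → ℝ) (Γ : List (ContourStep D)) :
    Complex.exp (Complex.I * ((e * s * contourSum η B Γ : ℝ) : ℂ)) = (Γ.map (stepTransporter e s η B)).prod := by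
  induction Γ with
  | nil => simp
  | cons st Γ ih =>
      rw [contourSum_cons, List.map_cons, List.prod_cons, ← ih, stepTransporter, ← Complex.exp_add]
      congr 1
      push_cast
      ring

end Ordered

end Summit.QuantumFields.YangMills.BalabanUVNodes.N15KingModelRung.Contour

end
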